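import Mathlib
import Summits.NavierStokesRegularity.NavierStokesRegularity.Theorems.TaoLadderRungTwoBreakBlowupRigidityOneOutflowCore
import Summits.NavierStokesRegularity.NavierStokesRegularity.Theorems.TaoLadderRungTwoBreakBlowupRigidityOneExtinguishableCore
import Summits.NavierStokesRegularity.NavierStokesRegularity.Theorems.TaoLadderRungTwoBreakTwinRotorTableDefs
import HarnessLib

/-!
# The PERPETUAL-CORE normal form: a robust blow-up forces a self-sustaining core of modes admitting NO finite internal
  support chain — the by-name census form of `…ExtinguishableCore`, strictly sharpening the outflow-live-core normal form
  of `…OutflowCore` for K2(1) `TaoLadderRungTwoBreak.BlowupRigidityOne` (stmt-NavierStokesRegularity-20206; `--supports`)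

MODEL lattice ODEs only (Tao 2016 §4 (4.1)–(4.3), Lemma 4.1 (4.5)–(4.8), Thm. 4.2 statement shape); nothing here is a
statement about the Navier–Stokes equations; NO item is closed.  DEF-FREE.  This module sits inside the route cone (it
imports `…OutflowCore`, which imports the route file, for the two by-name forms); the route-independent mathematics is
`…ExtinguishableCore`.

THE DICHOTOMY (`perpetualCore_or_extinguishable`).  Let `C⋆` be the union of all self-sustaining cores of the table (a core;
every table is peelable off `C⋆`, `peelableOn_of_no_core_off`).  Either `C⋆` admits NO internal support chain
`C⋆ = E 0, E 1, …, E (L+1) = ∅` (conditions (O), (A), (B) of `…FiniteDepth` for outputs in `C⋆`) — a PERPETUAL core — or the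
table is peelable off a set carrying such a chain, and then (`not_noGlobalCascade_of_peelable_internalChain`) it never
blows up robustly, at any `ε₀ > 0`, from any one-shell datum.

* `perpetualCore_of_noGlobalCascade` — NUMBER FOR THE CENSUS: a robust blow-up forces a perpetual core.  Strictly sharper
  than `outflowCore_of_noGlobalCascade`: a perpetual core emits into itself (else `E 1 = ∅` is a chain), while the
  single-feed pair of `…ExtinguishableCore` (`x_a x_b ↦ y_a`, drain `x_a y_a ↦ x_b`, nothing else; in `E₂(1)`) is an
  outflow-live core extinguished by `{a,b} ⊋ {a} ⊋ ∅`;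
* `internalChain_pair_of_single_feed` / `twinRotor_perpetualCore` — BOTH branches of the dichotomy are inhabited inside
  `E₂(1)`: a single-feed pair is extinguished by `{a,b} ⊋ {a} ⊋ ∅`, while the twin-rotor table of `…TwinRotorTableDefs`
  (both cross feeds `x₀x₁ ↦ y₀, y₁` live) has the perpetual core `{0, 1}` — every internal chain from `{0,1}` is constant;
* `blowupRigidityOne_iff_perpetualCore`, `target_iff_perpetualCore` — K2(1) and the rung leaf `Target` need only be
  proved on tables with a perpetual core.

Where the support-only method now stands: perpetual ⊋ twin-fed pairs (`pair_normalForm_of_noGlobalCascade`, `R < 2`) ∪ the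
dyadic member (`x² ↦ y`, `R ≥ 2`) ∪ Tao-type circuits; deciding robust blow-up on a perpetual core is ANALYTIC (the
remaining lemma list (B1)–(B4), (CL), (D) of the item's census), not combinatorial.

HONEST LABEL: bookkeeping normal form for the planner; no stub, crux, rung or summit is proved; rung 0.
-/

noncomputable section

-- the summit and its single sub-problem share the name (CONVENTIONS §1)
set_option linter.dupNamespace false

open Set Filter Topology MeasureTheory
open scoped RealInnerProductSpace

namespace Summit.NavierStokesRegularity.NavierStokesRegularity.Theorems

namespace BlowupRigidityOne

open Literature.Analysis.FluidPDE Literature.Analysis.FluidPDE.TaoCascade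
  Literature.Analysis.FluidPDE.Tao2016AveragedNS
open Summit.NavierStokesRegularity.NavierStokesRegularity.Theorems.TaoLadderRungTwoBreakTwinRotor

variable {m : ℕ} {R ε₀ : ℝ} {α : Fin m → Fin m → Fin m → ℤ × ℤ × ℤ → ℝ}

/-! ## The dichotomy: a perpetual core, or peelable off an extinguishable set -/

/-- **DICHOTOMY: a perpetual core, or peelable off an extinguishable set.**  For every table, EITHER some self-sustaining
core `C` (every member driven from `C × C`) admits NO internal support chain `C = E 0, …, E (L+1) = ∅` (with (O) outflow
of `E l × E l` into `C` lands in `E (l+1)`, (A) rotor of `E l × E l` into `C` stays in `E l`, (B) back-reaction of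
`E (l+1) × E l` into `C` stays in `E l`), OR there are a set `C`, a ranking with (P) every driver of a mode outside `C` has
an input outside `C` of lower rank, and an internal support chain of `C` reaching `∅`.  (Take `C` = the union of all
cores.)
[cite: Tao2016AveragedNS, §4 (4.1); cell vocabulary (self-sustaining core, perpetual core, internal support chain)] -/
theorem perpetualCore_or_extinguishable (α : Fin m → Fin m → Fin m → ℤ × ℤ × ℤ → ℝ) :
    (∃ C : Finset (Fin m), (∀ i ∈ C, ∃ μ ∈ shiftSet, ∃ j ∈ C, ∃ k ∈ C, α j k i μ ≠ 0) ∧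
      ¬ ∃ (L : ℕ) (E : ℕ → Finset (Fin m)), E 0 = C ∧ E (L + 1) = ∅ ∧ (∀ l, E l ⊆ C) ∧
        (∀ l j k i, j ∈ E l → k ∈ E l → i ∈ C → i ∉ E (l + 1) →
          α j k i ((0 : ℤ), (0 : ℤ), (1 : ℤ)) = 0) ∧
        (∀ l j k i, j ∈ E l → k ∈ E l → i ∈ C → i ∉ E l →
          α j k i ((0 : ℤ), (0 : ℤ), (0 : ℤ)) = 0) ∧
        (∀ l j k i, j ∈ E (l + 1) → k ∈ E l → i ∈ C → i ∉ E l →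
          α j k i ((1 : ℤ), (0 : ℤ), (0 : ℤ)) = 0 ∧ α k j i ((0 : ℤ), (1 : ℤ), (0 : ℤ)) = 0)) ∨
    (∃ (C : Finset (Fin m)) (rank : Fin m → ℕ),
      (∀ μ ∈ shiftSet, ∀ j k i, i ∉ C → α j k i μ ≠ 0 →
        (j ∉ C ∧ rank j < rank i) ∨ (k ∉ C ∧ rank k < rank i)) ∧
      ∃ (L : ℕ) (E : ℕ → Finset (Fin m)), E 0 = C ∧ E (L + 1) = ∅ ∧ (∀ l, E l ⊆ C) ∧
        (∀ l j k i, j ∈ E l → k ∈ E l → i ∈ C → i ∉ E (l + 1) →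
          α j k i ((0 : ℤ), (0 : ℤ), (1 : ℤ)) = 0) ∧
        (∀ l j k i, j ∈ E l → k ∈ E l → i ∈ C → i ∉ E l →
          α j k i ((0 : ℤ), (0 : ℤ), (0 : ℤ)) = 0) ∧
        (∀ l j k i, j ∈ E (l + 1) → k ∈ E l → i ∈ C → i ∉ E l →
          α j k i ((1 : ℤ), (0 : ℤ), (0 : ℤ)) = 0 ∧ α k j i ((0 : ℤ), (1 : ℤ), (0 : ℤ)) = 0)) := by
  classical
  -- the union of all cores
  set C : Finset (Fin m) := Finset.univ.filter fun i => ∃ C' : Finset (Fin m), i ∈ C' ∧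
    ∀ i' ∈ C', ∃ μ ∈ shiftSet, ∃ j ∈ C', ∃ k ∈ C', α j k i' μ ≠ 0 with hC
  have hCcore : ∀ i ∈ C, ∃ μ ∈ shiftSet, ∃ j ∈ C, ∃ k ∈ C, α j k i μ ≠ 0 := by
    intro i hi
    rw [hC, Finset.mem_filter] at hi
    obtain ⟨-, C', hiC', hcore'⟩ := hi
    have hsub : C' ⊆ C := by
      intro i' hi'
      rw [hC, Finset.mem_filter]
      exact ⟨Finset.mem_univ _, C', hi', hcore'⟩
    obtain ⟨μ, hμ, j, hj, k, hk, hne⟩ := hcore' i hiC'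
    exact ⟨μ, hμ, j, hsub hj, k, hsub hk, hne⟩
  by_cases hchain : ∃ (L : ℕ) (E : ℕ → Finset (Fin m)), E 0 = C ∧ E (L + 1) = ∅ ∧ (∀ l, E l ⊆ C) ∧
      (∀ l j k i, j ∈ E l → k ∈ E l → i ∈ C → i ∉ E (l + 1) →
        α j k i ((0 : ℤ), (0 : ℤ), (1 : ℤ)) = 0) ∧
      (∀ l j k i, j ∈ E l → k ∈ E l → i ∈ C → i ∉ E l →
        α j k i ((0 : ℤ), (0 : ℤ), (0 : ℤ)) = 0) ∧
      (∀ l j k i, j ∈ E (l + 1) → k ∈ E l → i ∈ C → i ∉ E l →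
        α j k i ((1 : ℤ), (0 : ℤ), (0 : ℤ)) = 0 ∧ α k j i ((0 : ℤ), (1 : ℤ), (0 : ℤ)) = 0)
  · right
    -- relative peeling off `C` (verbatim the argument of `outflowCore_or_peelable`)
    have hno : ∀ D : Finset (Fin m), D.Nonempty → Disjoint D C →
        ∃ i ∈ D, ∀ μ ∈ shiftSet, ∀ j ∈ D ∪ C, ∀ k ∈ D ∪ C, α j k i μ = 0 := by
      intro D hD hDC
      by_contra hcon
      push Not at hcon
      have hcore' : ∀ i' ∈ D ∪ C, ∃ μ ∈ shiftSet, ∃ j ∈ D ∪ C, ∃ k ∈ D ∪ C, α j k i' μ ≠ 0 := by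
        intro i' hi'
        rcases Finset.mem_union.1 hi' with h | h
        · exact hcon i' h
        · obtain ⟨μ, hμ, j, hj, k, hk, hne⟩ := hCcore i' h
          exact ⟨μ, hμ, j, Finset.mem_union_right _ hj, k, Finset.mem_union_right _ hk, hne⟩
      obtain ⟨i₀, hi₀⟩ := hD
      have hi₀C : i₀ ∈ C := by
        rw [hC, Finset.mem_filter]
        exact ⟨Finset.mem_univ _, D ∪ C, Finset.mem_union_left _ hi₀, hcore'⟩
      exact Finset.disjoint_left.1 hDC hi₀ hi₀C
    obtain ⟨rank, hr⟩ := peelableOn_of_no_core_off C hno (Finset.univ \ C) Finset.sdiff_disjoint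
    refine ⟨C, rank, fun μ hμ j k i hi hne => ?_, hchain⟩
    have hiS : i ∈ Finset.univ \ C := Finset.mem_sdiff.2 ⟨Finset.mem_univ _, hi⟩
    have huniv : ∀ l : Fin m, l ∈ (Finset.univ \ C) ∪ C := by
      intro l
      rw [Finset.mem_union]
      by_cases h : l ∈ C
      · exact Or.inr h
      · exact Or.inl (Finset.mem_sdiff.2 ⟨Finset.mem_univ _, h⟩)
    rcases hr μ hμ i hiS j (huniv j) k (huniv k) hne with ⟨hj, h⟩ | ⟨hk, h⟩
    · exact Or.inl ⟨(Finset.mem_sdiff.1 hj).2, h⟩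
    · exact Or.inr ⟨(Finset.mem_sdiff.1 hk).2, h⟩
  · exact Or.inl ⟨C, hCcore, hchain⟩

/-- **A ROBUST BLOW-UP FORCES A PERPETUAL CORE.**  If `α ∈ E₂(R)` and `NoGlobalCascade ε₀ α X₀` (`ε₀ > 0`), then some
self-sustaining core `C` of modes admits NO internal support chain reaching `∅` — the exact lattice restricted to `C` can
never be extinguished shell by shell (`perpetualCore_or_extinguishable` + `not_noGlobalCascade_of_peelable_internalChain`).
Sharpens `outflowCore_of_noGlobalCascade` (a perpetual core emits into itself; the single-feed pair is outflow-live but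
extinguishable).
[cite: Tao2016AveragedNS, §4 Thm. 4.2 (statement shape); cell vocabulary (`NoGlobalCascade`, perpetual core)] -/
theorem perpetualCore_of_noGlobalCascade (hε : 0 < ε₀) (hα : InTableClass R α) {X₀ : Fin m → ℝ}
    (hNG : NoGlobalCascade ε₀ α X₀) :
    ∃ C : Finset (Fin m), (∀ i ∈ C, ∃ μ ∈ shiftSet, ∃ j ∈ C, ∃ k ∈ C, α j k i μ ≠ 0) ∧
      ¬ ∃ (L : ℕ) (E : ℕ → Finset (Fin m)), E 0 = C ∧ E (L + 1) = ∅ ∧ (∀ l, E l ⊆ C) ∧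
        (∀ l j k i, j ∈ E l → k ∈ E l → i ∈ C → i ∉ E (l + 1) →
          α j k i ((0 : ℤ), (0 : ℤ), (1 : ℤ)) = 0) ∧
        (∀ l j k i, j ∈ E l → k ∈ E l → i ∈ C → i ∉ E l →
          α j k i ((0 : ℤ), (0 : ℤ), (0 : ℤ)) = 0) ∧
        (∀ l j k i, j ∈ E (l + 1) → k ∈ E l → i ∈ C → i ∉ E l →
          α j k i ((1 : ℤ), (0 : ℤ), (0 : ℤ)) = 0 ∧ α k j i ((0 : ℤ), (1 : ℤ), (0 : ℤ)) = 0) := by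
  rcases perpetualCore_or_extinguishable α with h | ⟨C, rank, hpeel, L, E, hE0, hEL, hEC, hOi, hAi, hBi⟩
  · exact h
  · exact absurd hNG (not_noGlobalCascade_of_peelable_internalChain hε hα hpeel hE0 hEL hEC hOi hAi hBi X₀)

/-- **An outflow-live core that is NOT perpetual exists: the sharpening is strict.**  On ANY table, a pair `{a, b}` with
`α_{ab b,(0,0,1)} = α_{ba b,(0,0,1)} = 0`, no square outflow (`α_{aa i,(0,0,1)} = α_{bb i,(0,0,1)} = 0`) and no rotor
inside the pair admits the internal support chain `{a,b}, {a}, ∅` — whatever its feed `α_{ab a,(0,0,1)}` and its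
back-reaction constants are (condition (B) is vacuous on such a chain).  With `α_{ab a,(0,0,1)} ≠ 0` and the drain
`α_{aa b,(0,1,0)} ≠ 0` the pair is a self-sustaining outflow-live core, yet extinguishable.
[cite: Tao2016AveragedNS, §4 (4.1); cell vocabulary (internal support chain)] -/
theorem internalChain_pair_of_single_feed (α : Fin m → Fin m → Fin m → ℤ × ℤ × ℤ → ℝ) {a b : Fin m}
    (hv : α a b b ((0 : ℤ), (0 : ℤ), (1 : ℤ)) = 0) (hv' : α b a b ((0 : ℤ), (0 : ℤ), (1 : ℤ)) = 0)
    (hsqa : ∀ i, α a a i ((0 : ℤ), (0 : ℤ), (1 : ℤ)) = 0) (hsqb : ∀ i, α b b i ((0 : ℤ), (0 : ℤ), (1 : ℤ)) = 0)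
    (hrot : ∀ j k i, (j = a ∨ j = b) → (k = a ∨ k = b) → (i = a ∨ i = b) →
      α j k i ((0 : ℤ), (0 : ℤ), (0 : ℤ)) = 0) :
    ∃ (L : ℕ) (E : ℕ → Finset (Fin m)), E 0 = ({a, b} : Finset (Fin m)) ∧ E (L + 1) = ∅ ∧
      (∀ l, E l ⊆ ({a, b} : Finset (Fin m))) ∧
      (∀ l j k i, j ∈ E l → k ∈ E l → i ∈ ({a, b} : Finset (Fin m)) → i ∉ E (l + 1) →
        α j k i ((0 : ℤ), (0 : ℤ), (1 : ℤ)) = 0) ∧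
      (∀ l j k i, j ∈ E l → k ∈ E l → i ∈ ({a, b} : Finset (Fin m)) → i ∉ E l →
        α j k i ((0 : ℤ), (0 : ℤ), (0 : ℤ)) = 0) ∧
      (∀ l j k i, j ∈ E (l + 1) → k ∈ E l → i ∈ ({a, b} : Finset (Fin m)) → i ∉ E l →
        α j k i ((1 : ℤ), (0 : ℤ), (0 : ℤ)) = 0 ∧ α k j i ((0 : ℤ), (1 : ℤ), (0 : ℤ)) = 0) := by
  classical
  have mem_pair : ∀ i : Fin m, i ∈ ({a, b} : Finset (Fin m)) ↔ i = a ∨ i = b := fun i => by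
    rw [Finset.mem_insert, Finset.mem_singleton]
  let E : ℕ → Finset (Fin m) := fun l => if l = 0 then {a, b} else if l = 1 then {a} else ∅
  have hE0 : E 0 = {a, b} := rfl
  have hE1 : E 1 = {a} := rfl
  have hEge : ∀ l, 2 ≤ l → E l = ∅ := by
    intro l hl
    show (if l = 0 then {a, b} else if l = 1 then {a} else ∅) = (∅ : Finset (Fin m))
    rw [if_neg (by omega), if_neg (by omega)]
  have hEC : ∀ l, E l ⊆ ({a, b} : Finset (Fin m)) := by
    intro l
    rcases Nat.lt_or_ge l 2 with hl | hl
    · interval_cases l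
      · exact le_of_eq hE0
      · rw [hE1]
        intro i hi
        rw [Finset.mem_singleton] at hi
        rw [mem_pair]
        exact Or.inl hi
    · rw [hEge l hl]
      exact Finset.empty_subset _
  refine ⟨1, E, hE0, hEge 2 le_rfl, hEC, ?_, ?_, ?_⟩
  · intro l j k i hj hk hiC hi
    rcases Nat.lt_or_ge l 2 with hl | hl
    · interval_cases l
      · rw [hE0, mem_pair] at hj hk
        have hib : i = b := by
          rw [mem_pair] at hiC
          rcases hiC with h | h
          · exact absurd (by rw [hE1, Finset.mem_singleton]; exact h) hi
          · exact h
        rcases hj with hj | hj <;> rcases hk with hk | hk <;> rw [hj, hk, hib]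
        · exact hsqa b
        · exact hv
        · exact hv'
        · exact hsqb b
      · rw [hE1, Finset.mem_singleton] at hj hk
        rw [hj, hk]
        exact hsqa i
    · rw [hEge l hl] at hj
      exact absurd hj (Finset.notMem_empty j)
  · intro l j k i hj hk hiC _
    have hj' := hEC l hj
    have hk' := hEC l hk
    rw [mem_pair] at hj' hk' hiC
    exact hrot j k i hj' hk' hiC
  · intro l j k i hj _ hiC hi
    rcases Nat.eq_zero_or_pos l with rfl | hl
    · exact absurd (by rw [hE0]; exact hiC) hi
    · rw [hEge (l + 1) (by omega)] at hj
      exact absurd hj (Finset.notMem_empty j)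

/-- **THE TWIN-ROTOR TABLE HAS A PERPETUAL CORE.**  For the twin-rotor table of `…TwinRotorTableDefs` (`∈ E₂(R)` for every
`R ≥ 1`; cross feeds `α_{01 i,(0,0,1)} = 1` for `i = 0, 1`) the pair `{0, 1}` is a self-sustaining core admitting NO
internal support chain to `∅`: condition (O) forces every level of a chain starting at `{0,1}` to contain both twins, so
no level is empty.  Hence the left branch of `perpetualCore_or_extinguishable` is inhabited below the dyadic spread (and
the support-only method says nothing about this table: its robust blow-up is the dyadic member's, `…TwinRotorPseudo`).
[cite: Tao2016AveragedNS, §4 (4.1)–(4.3); cell vocabulary (twin-rotor table, perpetual core)] -/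
theorem twinRotor_perpetualCore :
    ∃ C : Finset (Fin 4), (∀ i ∈ C, ∃ μ ∈ shiftSet, ∃ j ∈ C, ∃ k ∈ C, twinRotorTable j k i μ ≠ 0) ∧
      ¬ ∃ (L : ℕ) (E : ℕ → Finset (Fin 4)), E 0 = C ∧ E (L + 1) = ∅ ∧ (∀ l, E l ⊆ C) ∧
        (∀ l j k i, j ∈ E l → k ∈ E l → i ∈ C → i ∉ E (l + 1) →
          twinRotorTable j k i ((0 : ℤ), (0 : ℤ), (1 : ℤ)) = 0) ∧
        (∀ l j k i, j ∈ E l → k ∈ E l → i ∈ C → i ∉ E l →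
          twinRotorTable j k i ((0 : ℤ), (0 : ℤ), (0 : ℤ)) = 0) ∧
        (∀ l j k i, j ∈ E (l + 1) → k ∈ E l → i ∈ C → i ∉ E l →
          twinRotorTable j k i ((1 : ℤ), (0 : ℤ), (0 : ℤ)) = 0 ∧
            twinRotorTable k j i ((0 : ℤ), (1 : ℤ), (0 : ℤ)) = 0) := by
  classical
  have h001 : ((0 : ℤ), (0 : ℤ), (1 : ℤ)) ∈ shiftSet := by simp [shiftSet]
  -- the two live cross feeds
  have hfeed : ∀ i : Fin 4, i ∈ ({0, 1} : Finset (Fin 4)) →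
      twinRotorTable 0 1 i ((0 : ℤ), (0 : ℤ), (1 : ℤ)) = 1 := by
    intro i hi
    rw [Finset.mem_insert, Finset.mem_singleton] at hi
    rcases hi with rfl | rfl <;> simp [twinRotorTable]
  have h0 : (0 : Fin 4) ∈ ({0, 1} : Finset (Fin 4)) := by simp
  have h1 : (1 : Fin 4) ∈ ({0, 1} : Finset (Fin 4)) := by simp
  refine ⟨{0, 1}, fun i hi => ⟨_, h001, 0, h0, 1, h1, by rw [hfeed i hi]; exact one_ne_zero⟩, ?_⟩
  rintro ⟨L, E, hE0, hEL, hEC, hOi, -, -⟩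
  -- every level contains both twins
  have hall : ∀ l, E l = ({0, 1} : Finset (Fin 4)) := by
    intro l
    induction l with
    | zero => exact hE0
    | succ l ih =>
        refine le_antisymm (hEC (l + 1)) ?_
        intro i hi
        by_contra hmem
        have h := hOi l 0 1 i (by rw [ih]; exact h0) (by rw [ih]; exact h1) hi hmem
        rw [hfeed i hi] at h
        exact one_ne_zero h
  have h := hall (L + 1)
  rw [hEL] at h
  exact absurd (h ▸ h0 : (0 : Fin 4) ∈ (∅ : Finset (Fin 4))) (Finset.notMem_empty _)

end BlowupRigidityOne

/-! ## By name: K2(1) and the rung leaf live on tables with a perpetual core -/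

namespace BlowupRigidityOne

open Literature.Analysis.FluidPDE Literature.Analysis.FluidPDE.TaoCascade
open Summit.NavierStokesRegularity.NavierStokesRegularity.Theses.TaoLadderRungTwoBreak

/-- **K2(1) ⟺ K2(1) ON TABLES WITH A PERPETUAL CORE.**  `BlowupRigidityOne` is equivalent to the same implication
demanded only of tables carrying a self-sustaining core with no internal support chain to `∅`: on every other table of
`E₂(R)` there is no robust blow-up at any `ε₀ > 0` (`perpetualCore_of_noGlobalCascade`).
[cite: Tao2016AveragedNS, §4 Thm. 4.2 (statement shape); cell vocabulary (K2(1), perpetual core)] -/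
theorem blowupRigidityOne_iff_perpetualCore :
    BlowupRigidityOne ↔
      ∀ R : ℝ, 1 ≤ R → ∃ εs : ℝ, 0 < εs ∧ ∀ ε₀ : ℝ, 0 < ε₀ → ε₀ ≤ εs →
        ∀ (α : Fin 4 → Fin 4 → Fin 4 → ℤ × ℤ × ℤ → ℝ) (X₀ : Fin 4 → ℝ), InTableClass R α →
          (∃ C : Finset (Fin 4), (∀ i ∈ C, ∃ μ ∈ shiftSet, ∃ j ∈ C, ∃ k ∈ C, α j k i μ ≠ 0) ∧
            ¬ ∃ (L : ℕ) (E : ℕ → Finset (Fin 4)), E 0 = C ∧ E (L + 1) = ∅ ∧ (∀ l, E l ⊆ C) ∧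
              (∀ l j k i, j ∈ E l → k ∈ E l → i ∈ C → i ∉ E (l + 1) →
                α j k i ((0 : ℤ), (0 : ℤ), (1 : ℤ)) = 0) ∧
              (∀ l j k i, j ∈ E l → k ∈ E l → i ∈ C → i ∉ E l →
                α j k i ((0 : ℤ), (0 : ℤ), (0 : ℤ)) = 0) ∧
              (∀ l j k i, j ∈ E (l + 1) → k ∈ E l → i ∈ C → i ∉ E l →
                α j k i ((1 : ℤ), (0 : ℤ), (0 : ℤ)) = 0 ∧ α k j i ((0 : ℤ), (1 : ℤ), (0 : ℤ)) = 0)) →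
          NoGlobalCascade ε₀ α X₀ →
            ∃ (q : ℕ) (π : Equiv.Perm (Fin q)) (T : ℝ) (Φ : Fin q → ℝ → Em 4),
              IsDSSWave ε₀ α π T Φ ∧ Surviving 1 ε₀ T ∧ ∃ r x, Φ r x ≠ 0 := by
  constructor
  · intro h R hR
    obtain ⟨εs, hεs, H⟩ := h R hR
    exact ⟨εs, hεs, fun ε₀ hε hle α X₀ hα _ hNG => H ε₀ hε hle α X₀ hα hNG⟩
  · intro h R hR
    obtain ⟨εs, hεs, H⟩ := h R hR
    refine ⟨εs, hεs, fun ε₀ hε hle α X₀ hα hNG => H ε₀ hε hle α X₀ hα ?_ hNG⟩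
    exact perpetualCore_of_noGlobalCascade hε hα hNG

/-- **The rung leaf ⟺ the rung leaf ON TABLES WITH A PERPETUAL CORE.**  `Target` (BP-D-latt) is equivalent to the same
statement demanded only of tables with a self-sustaining core admitting no internal support chain to `∅`.
[cite: Tao2016AveragedNS, §4 Thm. 4.2 (statement shape); cell vocabulary (`Target` = `RungTwoBreakLatt`, perpetual core)] -/
theorem target_iff_perpetualCore :
    Target ↔
      ∀ R : ℝ, 1 ≤ R → ∃ εR : ℝ, 0 < εR ∧ ∀ ε₀ : ℝ, 0 < ε₀ → ε₀ ≤ εR →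
        ∀ (α : Fin 4 → Fin 4 → Fin 4 → ℤ × ℤ × ℤ → ℝ) (X₀ : Fin 4 → ℝ), InTableClass R α →
          (∃ C : Finset (Fin 4), (∀ i ∈ C, ∃ μ ∈ shiftSet, ∃ j ∈ C, ∃ k ∈ C, α j k i μ ≠ 0) ∧
            ¬ ∃ (L : ℕ) (E : ℕ → Finset (Fin 4)), E 0 = C ∧ E (L + 1) = ∅ ∧ (∀ l, E l ⊆ C) ∧
              (∀ l j k i, j ∈ E l → k ∈ E l → i ∈ C → i ∉ E (l + 1) →
                α j k i ((0 : ℤ), (0 : ℤ), (1 : ℤ)) = 0) ∧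
              (∀ l j k i, j ∈ E l → k ∈ E l → i ∈ C → i ∉ E l →
                α j k i ((0 : ℤ), (0 : ℤ), (0 : ℤ)) = 0) ∧
              (∀ l j k i, j ∈ E (l + 1) → k ∈ E l → i ∈ C → i ∉ E l →
                α j k i ((1 : ℤ), (0 : ℤ), (0 : ℤ)) = 0 ∧ α k j i ((0 : ℤ), (1 : ℤ), (0 : ℤ)) = 0)) →
          ¬ NoGlobalCascade ε₀ α X₀ := by
  constructor
  · intro h R hR
    obtain ⟨εR, hεR, H⟩ := h R hR
    exact ⟨εR, hεR, fun ε₀ hε hle α X₀ hα _ => H ε₀ hε hle α X₀ hα⟩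
  · intro h R hR
    obtain ⟨εR, hεR, H⟩ := h R hR
    refine ⟨εR, hεR, fun ε₀ hε hle α X₀ hα hNG => ?_⟩
    exact H ε₀ hε hle α X₀ hα (perpetualCore_of_noGlobalCascade hε hα hNG) hNG

end BlowupRigidityOne

end Summit.NavierStokesRegularity.NavierStokesRegularity.Theorems

end
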